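import Mathlib
import Summits.ValiantsHypothesis.ValiantsHypothesis.Theorems.NewtonUnitEquationsNewtonTauWeakAutomatonRadixDefs
import Summits.ValiantsHypothesis.ValiantsHypothesis.Theorems.NewtonUnitEquationsNewtonTauWeakAutomatonRadixCoeff
import Summits.ValiantsHypothesis.ValiantsHypothesis.Theorems.NewtonUnitEquationsNewtonTauWeakAutomatonGenSupport

/-!
# `NewtonUnitEquationsNewtonTauWeakAutomatonRadixSupport` — mixed-radix carry automaton: support in the radix box

Rung toward the crux `NewtonTauWeak` (stmt-ValiantsHypothesis-5904), line `binomial-normal-form`, THEOREM C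
(mixed-radix carry automaton: radix pair `(bx, by)`, level polynomials of degree `≤ C` in each variable):
registered stub `stub_radSupport`, the generalisation of `stub_genSupport` (`…AutomatonGenSupport.lean`,
radix `(2, 2)`, p127873) to an arbitrary radix pair `bx, by ≥ 2`.

Claim.  If every level polynomial `G l i` has degree `≤ C` in each variable, then every exponent vector `e` in
the support of `radSum bx by k n c G = Σ_l c_l · Π_{i<n} G_{l,i}(x^{bx^i}, y^{by^i})` satisfies
`e 0 < bx^n (C+1)` and `e 1 < by^n (C+1)` (the support hypothesis of the greedy step of Theorem C).

Proof.  Partial degrees (`MvPolynomial.degreeOf`).  The radix substitution `x ↦ x^a, y ↦ y^b` sends the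
monomial `r x^u y^v` to `r x^{a u} y^{b v}`, so `radExpand a b φ = Σ_{(u,v) ∈ supp φ} φ[u,v] x^{a u} y^{b v}`
(`RadCoeffAux.radExpand_eq_sum`, `…RadixCoeff.lean`) and every exponent vector of `radExpand a b φ` is `(a u, b v)`
for some `(u, v)` in the support of `φ` (`support_sum`, `support_monomial_subset`), whence
`degreeOf 0 (radExpand a b φ) ≤ a · degreeOf 0 φ` and `degreeOf 1 (radExpand a b φ) ≤ b · degreeOf 1 φ`
(`degreeOf_le_iff`); the level polynomials have partial degrees `≤ C` (`GenSupportAux.degreeOf_level_le`).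
The `n`-level product then has `degreeOf 0 ≤ Σ_{i<n} bx^i C ≤ bx^n C - C` (`degreeOf_prod_le` and the
geometric-sum bound `Σ_{i<n} B^i C + C ≤ B^n C` for `B ≥ 2`, induction on `n`: `B^n C + B^n C ≤ B^{n+1} C`);
a scalar multiple does not increase it (`degreeOf_C_mul_le`), nor does the sum over the `k` products
(`degreeOf_sum_le`, `Finset.sup_le`); finally `e 0 ≤ degreeOf 0 ≤ bx^n C - C < bx^n (C+1)` for `e` in the
support (`monomial_le_degreeOf`), and likewise in the variable `y` with the radix `by`. [folklore]
-/

set_option linter.dupNamespace false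

noncomputable section

open scoped BigOperators
open MvPolynomial

namespace Summit.ValiantsHypothesis.ValiantsHypothesis.Theorems.NewtonTauWeakAutomaton

namespace RadSupportAux

/-- Every exponent vector of `radExpand a b φ` is `(a u, b v)` for some exponent vector `(u, v)` of `φ`
(from the monomial expansion `RadCoeffAux.radExpand_eq_sum`). [folklore] -/
theorem exists_of_mem_support_radExpand (a b : ℕ) (φ : MvPolynomial (Fin 2) ℂ) {m : Fin 2 →₀ ℕ}
    (hm : m ∈ (radExpand a b φ).support) :
    ∃ e ∈ φ.support, m = Finsupp.single 0 (a * e 0) + Finsupp.single 1 (b * e 1) := by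
  rw [RadCoeffAux.radExpand_eq_sum] at hm
  obtain ⟨e, he, hme⟩ := Finset.mem_biUnion.mp (support_sum hm)
  exact ⟨e, he, Finset.mem_singleton.mp (support_monomial_subset hme)⟩

/-- The radix substitution `x ↦ x^a, y ↦ y^b` multiplies a partial-degree bound by `a` in the variable `x`
(`j = 0`) and by `b` in the variable `y` (`j = 1`). [folklore] -/
theorem degreeOf_radExpand_le (j : Fin 2) (a b d : ℕ) (φ : MvPolynomial (Fin 2) ℂ)
    (h : degreeOf j φ ≤ d) : degreeOf j (radExpand a b φ) ≤ (if j = 0 then a else b) * d := by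
  rw [degreeOf_le_iff] at h ⊢
  intro m hm
  obtain ⟨e, he, rfl⟩ := exists_of_mem_support_radExpand a b φ hm
  have := h e he
  fin_cases j
  · simpa using Nat.mul_le_mul_left a this
  · simpa using Nat.mul_le_mul_left b this

/-- The geometric-sum bound `Σ_{i<n} B^i C + C ≤ B^n C` in a radix `B ≥ 2` (induction on `n`; the step is
`B^n C + B^n C ≤ B^{n+1} C`). -/
theorem sum_pow_mul_add_le (B n C : ℕ) (hB : 2 ≤ B) :
    ∑ i ∈ Finset.range n, B ^ i * C + C ≤ B ^ n * C := by
  induction n with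
  | zero => simp
  | succ n ih =>
    calc ∑ i ∈ Finset.range (n + 1), B ^ i * C + C
        = (∑ i ∈ Finset.range n, B ^ i * C + C) + B ^ n * C := by rw [Finset.sum_range_succ]; ring
      _ ≤ B ^ n * C + B ^ n * C := Nat.add_le_add_right ih _
      _ = 2 * (B ^ n * C) := by ring
      _ ≤ B * (B ^ n * C) := Nat.mul_le_mul_right _ hB
      _ = B ^ (n + 1) * C := by ring

/-- An `n`-level mixed-radix product `Π_{i<n} G_i(x^{bx^i}, y^{by^i})` of level polynomials of partial degrees
`≤ C` has partial degree at most `bx^n C - C` in `x` and at most `by^n C - C` in `y` (radices `bx, by ≥ 2`).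
[folklore] -/
theorem degreeOf_radProd_add_le (j : Fin 2) (bx by' C : ℕ) (hbx : 2 ≤ bx) (hby : 2 ≤ by')
    (G : ℕ → MvPolynomial (Fin 2) ℂ) (hG : ∀ i, ∀ e ∈ (G i).support, e 0 ≤ C ∧ e 1 ≤ C) (n : ℕ) :
    degreeOf j (radProd bx by' G n) + C ≤ (if j = 0 then bx else by') ^ n * C := by
  have hB : 2 ≤ (if j = 0 then bx else by') := by split_ifs <;> assumption
  refine le_trans ?_ (sum_pow_mul_add_le _ n C hB)
  unfold radProd
  refine Nat.add_le_add_right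
    ((degreeOf_prod_le j (Finset.range n) fun i => radExpand (bx ^ i) (by' ^ i) (G i)).trans
      (Finset.sum_le_sum fun i _ => ?_)) C
  refine (degreeOf_radExpand_le j (bx ^ i) (by' ^ i) C (G i)
    (GenSupportAux.degreeOf_level_le j C (G i) (hG i))).trans (le_of_eq ?_)
  split_ifs <;> rfl

/-- The `k`-sum of scalar multiples of `n`-level mixed-radix products (level polynomials of partial degrees
`≤ C`, radices `bx, by ≥ 2`) has partial degree at most `bx^n C - C` in `x` and at most `by^n C - C` in `y`.
[folklore] -/
theorem degreeOf_radSum_add_le (j : Fin 2) (bx by' k C n : ℕ) (hbx : 2 ≤ bx) (hby : 2 ≤ by')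
    (c : Fin k → ℂ) (G : Fin k → ℕ → MvPolynomial (Fin 2) ℂ)
    (hG : ∀ l i, ∀ e ∈ (G l i).support, e 0 ≤ C ∧ e 1 ≤ C) :
    degreeOf j (radSum bx by' k n c G) + C ≤ (if j = 0 then bx else by') ^ n * C := by
  have hprod := fun l => degreeOf_radProd_add_le j bx by' C hbx hby (G l) (hG l) n
  have hB : 2 ≤ (if j = 0 then bx else by') := by split_ifs <;> assumption
  generalize (if j = 0 then bx else by') = B at hprod hB
  have hpos : C ≤ B ^ n * C := Nat.le_mul_of_pos_left C (pow_pos (by omega) n)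
  unfold radSum
  have hsup : (Finset.univ.sup fun l : Fin k =>
      degreeOf j (MvPolynomial.C (c l) * radProd bx by' (G l) n)) ≤ B ^ n * C - C := by
    refine Finset.sup_le fun l _ => (degreeOf_C_mul_le _ _ _).trans ?_
    have := hprod l
    omega
  have := (degreeOf_sum_le j Finset.univ fun l : Fin k =>
    MvPolynomial.C (c l) * radProd bx by' (G l) n).trans hsup
  omega

end RadSupportAux

open RadSupportAux in
/-- **Support of a mixed-radix digit-scaled sum lies in the radix box.**  If every level polynomial `G l i`
has degree `≤ C` in each variable and the radices satisfy `bx, by ≥ 2`, then every exponent vector `e` in the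
support of `radSum bx by k n c G = Σ_l c_l · Π_{i<n} G_{l,i}(x^{bx^i}, y^{by^i})` satisfies
`e 0 < bx^n (C+1)` and `e 1 < by^n (C+1)` (indeed `e 0 ≤ bx^n C - C` and `e 1 ≤ by^n C - C`: the substitution
`x ↦ x^{bx^i}, y ↦ y^{by^i}` scales the partial degrees by `bx^i`, `by^i`, and `Σ_{i<n} B^i C ≤ B^n C - C` for
`B ≥ 2`).  This is the support hypothesis of the greedy step of THEOREM C; it generalises `stub_genSupport`
(radix `(2, 2)`). [folklore: carry automaton / transfer matrices of digit expansions, mixed radix] -/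
theorem stub_radSupport (bx by' k C n : ℕ) (hbx : 2 ≤ bx) (hby : 2 ≤ by') (c : Fin k → ℂ)
    (G : Fin k → ℕ → MvPolynomial (Fin 2) ℂ) (hG : ∀ l i, ∀ e ∈ (G l i).support, e 0 ≤ C ∧ e 1 ≤ C) :
    ∀ e ∈ (radSum bx by' k n c G).support, e 0 < bx ^ n * (C + 1) ∧ e 1 < by' ^ n * (C + 1) := by
  intro e he
  have key : ∀ j : Fin 2, e j < (if j = 0 then bx else by') ^ n * (C + 1) := by
    intro j
    have h1 : e j ≤ degreeOf j (radSum bx by' k n c G) := monomial_le_degreeOf j he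
    have h2 := degreeOf_radSum_add_le j bx by' k C n hbx hby c G hG
    have hB : 2 ≤ (if j = 0 then bx else by') := by split_ifs <;> assumption
    generalize (if j = 0 then bx else by') = B at h2 hB ⊢
    have h3 : B ^ n * (C + 1) = B ^ n * C + B ^ n := by ring
    have h4 : 0 < B ^ n := pow_pos (by omega) n
    omega
  exact ⟨by simpa using key 0, by simpa using key 1⟩

end Summit.ValiantsHypothesis.ValiantsHypothesis.Theorems.NewtonTauWeakAutomaton

end
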